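import Summits.ValiantsHypothesis.ValiantsHypothesis.Theorems.BarrierLeverChowHitsPartitionMinorsRStarvedTinv
import Summits.ValiantsHypothesis.ValiantsHypothesis.Theorems.BarrierLeverChowHitsPartitionMinorsRUnitFactors

/-!
# Route BarrierLever — item `ChowHitsPartitionMinorsR` (stmt-ValiantsHypothesis-21882), STARVED DESIGN III:
# NORMAL FORM — the thin partition matrix of `∏ ℓ_k` is nonsingular iff the `ρ̂`-matrix is

Helper file (`--supports stmt-ValiantsHypothesis-21882`; cell valiant-natproofs, rung V4, 𝒟-side; prover seat val-np-p5
gen 31). Closes NO item. Third file of the kernel chain for THEOREM A′ of memo MEMO-21882-valnp5-g31.md §3/§5 (K-A3a):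
for ANY finite family of affine forms `ℓ_k = 1 + Σ_a A k a x_a + Σ_c B k c y_c` (`k ∈ K ⊆ ι`), any row family `u` of sets
of size `≤ 2` and any injective, face-closed column family `w` of sets of size `≤ 3`,

  `det [coeff (E (u i) (w j)) ∏ℓ] ≠ 0  ↔  det [coeff (E ∅ (w j)) (rowPoly (u i))] ≠ 0`     (`det_partitionMatrix_prod_ne_zero_iff`)

where `rowPoly` is the EXPLICIT pure-`y` polynomial of the row (`rowPoly ∅ = 1`, `rowPoly {a} = ρ̂₁ a = Σ_k A k a · t_k`,
`rowPoly {a,b} = ρ̂₂ a b = Σ_k Σ_{k'≠k} A k a · A k' b · t_k t_{k'}`, `t_k = 1 − N_k + N_k² − N_k³` the truncated inverse of the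
`y`-part, `…RStarvedTinv` p724492): the pure-`y` unit `F = ∏_k (1 + N_k)` acts on the columns by a `⊆`-triangular matrix with
unit diagonal (`ChowFacePrivate.coeff_partitionExpo_mul_pureY`, `sum_powerset_eq_sum_rows`, `det_ne_zero_of_lowerTriangular_subset`,
p710189/p714053). Definitions `tinv`, `rho1`, `rho2`, `rowPoly` (abbreviations of explicit polynomials; reviewed).

WHAT THIS IS NOT: the `ρ̂`-determinant of the starved design is evaluated in the sequel (K-A3b); nothing on crux
stmt-ValiantsHypothesis-14610 or on `VP` versus `VNP`.
-/

set_option linter.dupNamespace false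

namespace Summit.ValiantsHypothesis.ValiantsHypothesis.Theorems.BarrierLever.ChowStarvedDesign

open Finset MvPolynomial
open Summit.ValiantsHypothesis.ValiantsHypothesis.Theorems.BarrierLever.ChowFactor
  (coeff_partitionExpo_mul_affineY)
open Summit.ValiantsHypothesis.ValiantsHypothesis.Theorems.BarrierLever.ChowFacePrivate
  (coeff_partitionExpo_mul_pureY sum_powerset_eq_sum_rows det_ne_zero_of_lowerTriangular_subset)

noncomputable section

variable {h : ℕ} {ι : Type*} [DecidableEq ι]

/-! ## 1. The explicit row polynomials -/

/-- The `y`-part `N_k = Σ_c B k c · y_c` of the form `k`. -/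
def linY (B : ι → Fin h → ℂ) (k : ι) : MvPolynomial (Fin (h + h)) ℂ := ∑ c, C (B k c) * X (Fin.natAdd h c)

/-- The degree-3 truncated inverse `t_k = 1 − N_k + N_k² − N_k³` of `1 + N_k`. -/
def tinv (B : ι → Fin h → ℂ) (k : ι) : MvPolynomial (Fin (h + h)) ℂ :=
  1 - linY B k + linY B k ^ 2 - linY B k ^ 3

/-- `ρ̂₁ a = Σ_{k∈K} A k a · t_k` (row `{a}` modulo the unit `F`). -/
def rho1 (A B : ι → Fin h → ℂ) (K : Finset ι) (a : Fin h) : MvPolynomial (Fin (h + h)) ℂ :=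
  ∑ k ∈ K, C (A k a) * tinv B k

/-- `ρ̂₂ a b = Σ_{k∈K} Σ_{k'∈K∖k} A k a · A k' b · t_k t_{k'}` (row `{a,b}` modulo the unit `F`). -/
def rho2 (A B : ι → Fin h → ℂ) (K : Finset ι) (a b : Fin h) : MvPolynomial (Fin (h + h)) ℂ :=
  ∑ k ∈ K, ∑ k' ∈ K.erase k, C (A k a * A k' b) * (tinv B k * tinv B k')

/-- The row polynomial of a set `U` of size `≤ 2`: `1`, `ρ̂₁ a`, `ρ̂₂ a b` (written without choice: for `|U| = 2` the
symmetric double sum counts `ρ̂₂ a b + ρ̂₂ b a = 2 ρ̂₂ a b`). -/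
def rowPoly (A B : ι → Fin h → ℂ) (K : Finset ι) (U : Finset (Fin h)) : MvPolynomial (Fin (h + h)) ℂ :=
  if U.card = 0 then 1 else if U.card = 1 then ∑ a ∈ U, rho1 A B K a
  else C (1 / 2 : ℂ) * ∑ a ∈ U, ∑ b ∈ U.erase a, rho2 A B K a b

/-- `ρ̂₂` is symmetric. -/
theorem rho2_comm (A B : ι → Fin h → ℂ) (K : Finset ι) (a b : Fin h) : rho2 A B K a b = rho2 A B K b a := by
  unfold rho2
  rw [Finset.sum_sigma' K (fun k => K.erase k), Finset.sum_sigma' K (fun k => K.erase k)]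
  refine Finset.sum_bij' (fun p _ => ⟨p.2, p.1⟩) (fun p _ => ⟨p.2, p.1⟩) ?_ ?_ ?_ ?_ ?_
  · intro p hp
    rw [Finset.mem_sigma] at hp ⊢
    exact ⟨Finset.mem_of_mem_erase hp.2,
      Finset.mem_erase.mpr ⟨fun e => (Finset.mem_erase.mp hp.2).1 e.symm, hp.1⟩⟩
  · intro p hp
    rw [Finset.mem_sigma] at hp ⊢
    exact ⟨Finset.mem_of_mem_erase hp.2,
      Finset.mem_erase.mpr ⟨fun e => (Finset.mem_erase.mp hp.2).1 e.symm, hp.1⟩⟩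
  · intro p _; rfl
  · intro p _; rfl
  · intro p _
    ring

/-- `rowPoly ∅ = 1`. -/
theorem rowPoly_empty (A B : ι → Fin h → ℂ) (K : Finset ι) : rowPoly A B K (∅ : Finset (Fin h)) = 1 := by
  simp [rowPoly]

/-- `rowPoly {a} = ρ̂₁ a`. -/
theorem rowPoly_singleton (A B : ι → Fin h → ℂ) (K : Finset ι) (a : Fin h) :
    rowPoly A B K ({a} : Finset (Fin h)) = rho1 A B K a := by
  simp [rowPoly]

/-- `rowPoly {a, b} = ρ̂₂ a b` (`a ≠ b`). -/
theorem rowPoly_pair (A B : ι → Fin h → ℂ) (K : Finset ι) (a b : Fin h) (hab : a ≠ b) :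
    rowPoly A B K ({a, b} : Finset (Fin h)) = rho2 A B K a b := by
  unfold rowPoly
  rw [if_neg (by rw [Finset.card_pair hab]; norm_num), if_neg (by rw [Finset.card_pair hab]; norm_num),
    Finset.sum_pair hab, Finset.erase_insert (Finset.notMem_singleton.mpr hab), Finset.sum_singleton,
    Finset.erase_insert_of_ne hab, Finset.erase_singleton, Finset.insert_empty, Finset.sum_singleton,
    rho2_comm A B K b a]
  calc C (1 / 2 : ℂ) * (rho2 A B K a b + rho2 A B K a b)
      = ((2 : MvPolynomial (Fin (h + h)) ℂ) * C (1 / 2 : ℂ)) * rho2 A B K a b := by ring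
    _ = rho2 A B K a b := by
        rw [show (2 : MvPolynomial (Fin (h + h)) ℂ) = C 2 from (map_ofNat C 2).symm, ← C_mul]
        norm_num

/-! ## 2. The thin rows of `∏ℓ` are `F · rowPoly` -/

/-- **The thin partition matrix of `∏ℓ` in normal form**: for `|U| ≤ 2` and `|T| ≤ 3`,
`coeff (E U T) ∏_{k∈K} ℓ_k = coeff (E ∅ T) (F · rowPoly U)`, `F = ∏_k (1 + N_k)`. -/
theorem coeff_prod_eq_coeff_F_mul_rowPoly (A B : ι → Fin h → ℂ) (K : Finset ι) (U : Finset (Fin h))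
    (hU : U.card ≤ 2) (T : Finset (Fin h)) (hT : T.card ≤ 3) :
    coeff (∑ a ∈ U, Finsupp.single (Fin.castAdd h a) 1 + ∑ c ∈ T, Finsupp.single (Fin.natAdd h c) 1)
        (∏ k ∈ K, ((C 1 + ∑ a, C (A k a) * X (Fin.castAdd h a) + ∑ c, C (B k c) * X (Fin.natAdd h c)) :
          MvPolynomial (Fin (h + h)) ℂ)) =
      coeff (∑ a ∈ (∅ : Finset (Fin h)), Finsupp.single (Fin.castAdd h a) 1 +
          ∑ c ∈ T, Finsupp.single (Fin.natAdd h c) 1)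
        ((∏ k ∈ K, ((1 + ∑ c, C (B k c) * X (Fin.natAdd h c)) : MvPolynomial (Fin (h + h)) ℂ)) * rowPoly A B K U) := by
  rcases Nat.lt_or_ge U.card 1 with h0 | h1
  · have hU0 : U = ∅ := Finset.card_eq_zero.mp (show U.card = 0 by omega)
    subst hU0
    rw [rowPoly_empty, mul_one, coeff_empty_prodForms]
  rcases Nat.lt_or_ge U.card 2 with h1' | h2
  · obtain ⟨a, rfl⟩ := Finset.card_eq_one.mp (show U.card = 1 by omega)
    rw [rowPoly_singleton, coeff_single_prod_eq A B K a T hT]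
    rfl
  · obtain ⟨a, b, hab, rfl⟩ := Finset.card_eq_two.mp (show U.card = 2 by omega)
    rw [rowPoly_pair A B K a b hab, coeff_pair_prod_eq A B K a b hab T hT]
    rfl

/-! ## 3. Discarding the pure-`y` unit `F` -/

omit [DecidableEq ι] in
/-- `F = ∏_k (1 + N_k)` is a pure-`y` polynomial: no coefficient with a nonempty `x`-part. -/
theorem coeff_prodY_eq_zero_of_ne_empty (B : ι → Fin h → ℂ) (K : Finset ι) :
    ∀ S T : Finset (Fin h), S ≠ ∅ → coeff (∑ a ∈ S, Finsupp.single (Fin.castAdd h a) 1 +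
          ∑ c ∈ T, Finsupp.single (Fin.natAdd h c) 1)
        (∏ k ∈ K, ((1 + ∑ c, C (B k c) * X (Fin.natAdd h c)) : MvPolynomial (Fin (h + h)) ℂ)) = 0 := by
  classical
  induction K using Finset.induction_on with
  | empty =>
    intro S T hS
    rw [Finset.prod_empty, coeff_one, if_neg]
    intro h0
    obtain ⟨a, ha⟩ := Finset.nonempty_iff_ne_empty.mpr hS
    have h1 := congrArg (fun v : Fin (h + h) →₀ ℕ => v (Fin.castAdd h a)) h0
    simp only [Finsupp.coe_zero, Pi.zero_apply, ProductStateSums.partitionExpo_apply_castAdd] at h1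
    rw [if_pos ha] at h1
    exact one_ne_zero h1.symm
  | insert k₀ K hk₀ ih =>
    intro S T hS
    rw [Finset.prod_insert hk₀, mul_comm, coeff_partitionExpo_mul_affineY, ih S T hS, zero_add]
    exact Finset.sum_eq_zero fun c _ => by rw [ih S (T.erase c) hS, mul_zero]

omit [DecidableEq ι] in
/-- The constant term of `F` is `1`. -/
theorem coeff_zero_prodY (B : ι → Fin h → ℂ) (K : Finset ι) :
    coeff (∑ a ∈ (∅ : Finset (Fin h)), Finsupp.single (Fin.castAdd h a) 1 +
          ∑ c ∈ (∅ : Finset (Fin h)), Finsupp.single (Fin.natAdd h c) 1)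
        (∏ k ∈ K, ((1 + ∑ c, C (B k c) * X (Fin.natAdd h c)) : MvPolynomial (Fin (h + h)) ℂ)) = 1 := by
  classical
  rw [Finset.sum_empty, Finset.sum_empty, add_zero, ← constantCoeff_eq, map_prod]
  refine Finset.prod_eq_one fun k _ => ?_
  rw [map_add, map_one, map_sum, Finset.sum_eq_zero, add_zero]
  intro c _
  rw [map_mul, constantCoeff_X, mul_zero]

/-- **NORMAL FORM.** For rows of size `≤ 2` and an injective, face-closed column family of sets of size `≤ 3`, the
partition matrix of `∏_{k∈K} ℓ_k` is nonsingular iff the coefficient matrix of the explicit row polynomials `rowPoly` is. -/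
theorem det_partitionMatrix_prod_ne_zero_iff {r : ℕ} (A B : ι → Fin h → ℂ) (K : Finset ι)
    (u w : Fin r → Finset (Fin h)) (hu2 : ∀ i, (u i).card ≤ 2)
    (hw : Function.Injective w) (hloww : ∀ j T, T ⊆ w j → ∃ k, w k = T) (hw3 : ∀ j, (w j).card ≤ 3) :
    (Matrix.of fun i j : Fin r => coeff (∑ a ∈ u i, Finsupp.single (Fin.castAdd h a) 1 +
          ∑ c ∈ w j, Finsupp.single (Fin.natAdd h c) 1)
        (∏ k ∈ K, ((C 1 + ∑ a, C (A k a) * X (Fin.castAdd h a) + ∑ c, C (B k c) * X (Fin.natAdd h c)) :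
          MvPolynomial (Fin (h + h)) ℂ))).det ≠ 0 ↔
      (Matrix.of fun i j : Fin r => coeff (∑ a ∈ (∅ : Finset (Fin h)), Finsupp.single (Fin.castAdd h a) 1 +
          ∑ c ∈ w j, Finsupp.single (Fin.natAdd h c) 1) (rowPoly A B K (u i))).det ≠ 0 := by
  classical
  set F : MvPolynomial (Fin (h + h)) ℂ :=
    ∏ k ∈ K, ((1 + ∑ c, C (B k c) * X (Fin.natAdd h c)) : MvPolynomial (Fin (h + h)) ℂ) with hF
  have hFy := coeff_prodY_eq_zero_of_ne_empty B K
  -- the matrix of `∏ℓ` = (ρ̂-matrix) · Φ_F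
  have hmat : (Matrix.of fun i j : Fin r => coeff (∑ a ∈ u i, Finsupp.single (Fin.castAdd h a) 1 +
          ∑ c ∈ w j, Finsupp.single (Fin.natAdd h c) 1)
        (∏ k ∈ K, ((C 1 + ∑ a, C (A k a) * X (Fin.castAdd h a) + ∑ c, C (B k c) * X (Fin.natAdd h c)) :
          MvPolynomial (Fin (h + h)) ℂ))) =
      (Matrix.of fun i k : Fin r => coeff (∑ a ∈ (∅ : Finset (Fin h)), Finsupp.single (Fin.castAdd h a) 1 +
          ∑ c ∈ w k, Finsupp.single (Fin.natAdd h c) 1) (rowPoly A B K (u i))) *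
        Matrix.of fun k j : Fin r => if w k ⊆ w j then coeff (∑ a ∈ (∅ : Finset (Fin h)), Finsupp.single (Fin.castAdd h a) 1 +
          ∑ c ∈ w j \ w k, Finsupp.single (Fin.natAdd h c) 1) F else 0 := by
    ext i j
    rw [Matrix.of_apply, coeff_prod_eq_coeff_F_mul_rowPoly A B K (u i) (hu2 i) (w j) (hw3 j), ← hF,
      mul_comm F, Matrix.mul_apply, coeff_partitionExpo_mul_pureY _ F hFy]
    have hR : ∀ k, (Matrix.of fun i k : Fin r => coeff (∑ a ∈ (∅ : Finset (Fin h)), Finsupp.single (Fin.castAdd h a) 1 +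
          ∑ c ∈ w k, Finsupp.single (Fin.natAdd h c) 1) (rowPoly A B K (u i))) i k *
      (Matrix.of fun k j : Fin r => if w k ⊆ w j then coeff (∑ a ∈ (∅ : Finset (Fin h)), Finsupp.single (Fin.castAdd h a) 1 +
          ∑ c ∈ w j \ w k, Finsupp.single (Fin.natAdd h c) 1) F else 0) k j =
      if w k ⊆ w j then coeff (∑ a ∈ (∅ : Finset (Fin h)), Finsupp.single (Fin.castAdd h a) 1 +
          ∑ c ∈ w k, Finsupp.single (Fin.natAdd h c) 1) (rowPoly A B K (u i)) *
          coeff (∑ a ∈ (∅ : Finset (Fin h)), Finsupp.single (Fin.castAdd h a) 1 +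
          ∑ c ∈ w j \ w k, Finsupp.single (Fin.natAdd h c) 1) F else 0 := by
      intro k
      rw [Matrix.of_apply, Matrix.of_apply, mul_ite, mul_zero]
    rw [Finset.sum_congr rfl (fun k _ => hR k),
      ← sum_powerset_eq_sum_rows w hw hloww j (fun T => coeff (∑ a ∈ (∅ : Finset (Fin h)), Finsupp.single (Fin.castAdd h a) 1 +
          ∑ c ∈ T, Finsupp.single (Fin.natAdd h c) 1) (rowPoly A B K (u i)) *
          coeff (∑ a ∈ (∅ : Finset (Fin h)), Finsupp.single (Fin.castAdd h a) 1 +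
          ∑ c ∈ w j \ T, Finsupp.single (Fin.natAdd h c) 1) F)]
  -- `Φ_F` is `⊆`-triangular with unit diagonal
  have hΦ : (Matrix.of fun k j : Fin r => if w k ⊆ w j then coeff (∑ a ∈ (∅ : Finset (Fin h)), Finsupp.single (Fin.castAdd h a) 1 +
          ∑ c ∈ w j \ w k, Finsupp.single (Fin.natAdd h c) 1) F else 0).det ≠ 0 := by
    rw [← Matrix.det_transpose]
    refine det_ne_zero_of_lowerTriangular_subset w hw _ (fun i k hik => ?_) (fun i => ?_)
    · by_contra hc
      exact hik (by rw [Matrix.transpose_apply, Matrix.of_apply, if_neg hc])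
    · rw [Matrix.transpose_apply, Matrix.of_apply, if_pos (Finset.Subset.refl _), Finset.sdiff_self, hF,
        coeff_zero_prodY]
      exact one_ne_zero
  rw [hmat, Matrix.det_mul, mul_ne_zero_iff]
  exact and_iff_left hΦ

end

end Summit.ValiantsHypothesis.ValiantsHypothesis.Theorems.BarrierLever.ChowStarvedDesign
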